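import Literature.AlgebraicGeometry.Frobenioids.KummerInflationOne
import Literature.AlgebraicGeometry.Frobenioids.PadicKummerRemark221
import HarnessLib

/-!
# Frobenioids II, Definition 2.2 (ii)(c): the range of the degree-one inflation maps

Mochizuki, *The geometry of Frobenioids II*, Kyushu J. Math. **62** (2008) 401–460, §2, Definition
2.2 (ii) p. 17 [cite: MochizukiFrdII2008, Def 2.2 (ii) p.17]. Proof-only companion of
`KummerReciprocity.lean` / `PadicKummerSetting.lean` (abc-iut-L1-t7), complementing
`KummerInflationOne.lean` (injectivity) and `PadicKummerRemark221.lean` (inflated classes vanish on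
the kernel): along a SURJECTION `q : H ↠ H_A`, for any topological `H_A`-module `X` on which `H`
acts through `q`,
* `Kummer.mem_range_infl_one_iff` — a class `[c] ∈ H¹(H, X)` is inflated from `H¹(H_A, X)` iff the
  continuous crossed homomorphism `c` vanishes on `Ker q` (descend `c` along `q`; `H_A` is discrete
  so the descended cocycle is continuous);
* `Kummer.infl_one_surjective_iff`, `Kummer.infl_one_bijective_iff` — the degree-one clauses of
  condition (c) hold iff EVERY continuous crossed homomorphism `H → X` vanishes on `Ker(H ↠ H_A)`;
* `PadicKummer.Def22Context.isNHSaturated_iff_oneCocycles` — Definition 2.2 (ii) restated for any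
  context `X` with (c)'s `H¹`-clauses in this "extension-field-theoretic" form (the form in which
  Remark 2.2.1 uses them), the `H²`-clause unchanged.
Universe note: `X : TopRep.{0}` as in `KummerInflationOne`. Nothing here concerns [IUTchIII].
-/

namespace Literature.AlgebraicGeometry.Frobenioids

open CategoryTheory Literature.NumberTheory.GaloisRepresentations

namespace Kummer

section Range

variable {Γ : Type} [Group Γ] {tΓ : TopologicalSpace Γ} {dΓ : DiscreteTopology Γ} (HA : Subgroup Γ)
  {H : Type} [Group H] [TopologicalSpace H] [IsTopologicalGroup H] (q : H →ₜ* HA)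

omit [IsTopologicalGroup H] in
/-- A continuous crossed homomorphism of `H` (acting through `q : H → H_A`) that vanishes on `Ker q`
takes the same value on `σ` and `σ k` for `q k = 1`. [cite: MochizukiFrdII2008, Def 2.2 (ii) p.17] -/
theorem oneCocycle_apply_eq_of_q_eq (X : TopRep.{0} ℤ HA)
    (c : contOneCocycles (TopRep.res (q : H →* HA) X)) (hc : ∀ σ, q σ = 1 → c.1 σ = 0)
    {σ σ' : H} (h : q σ = q σ') : c.1 σ = c.1 σ' := by
  have hk : q (σ⁻¹ * σ') = 1 := by rw [map_mul, map_inv, h, inv_mul_cancel]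
  have h1 := c.2 σ (σ⁻¹ * σ')
  rw [mul_inv_cancel_left, hc _ hk, map_zero, add_zero] at h1
  exact h1.symm

/-- **Descent of cocycles along `H ↠ H_A`**: for surjective `q`, a class `[c] ∈ H¹(H, X)` lies in
the image of the inflation `H¹(H_A, X) → H¹(H, X)` iff `c` vanishes on `Ker q` (`H_A` discrete, so
the descended crossed homomorphism `q σ ↦ c σ` is continuous). The "only if" half is
`Kummer.apply_eq_zero_of_mem_range_infl`. [cite: MochizukiFrdII2008, Def 2.2 (ii) p.17] -/
theorem mem_range_infl_one_iff (hq : Function.Surjective q) (X : TopRep.{0} ℤ HA)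
    (c : contOneCocycles (TopRep.res (q : H →* HA) X)) :
    oneCocycleClass _ c ∈ Set.range (infl HA q X 1).hom ↔ ∀ σ, q σ = 1 → c.1 σ = 0 := by
  refine ⟨fun h σ hσ => apply_eq_zero_of_mem_range_infl HA q X c h hσ, fun hc => ?_⟩
  -- the descended crossed homomorphism `ψ (q σ) := c σ`
  let s : HA → H := Function.surjInv hq
  have hs : ∀ τ, q (s τ) = τ := Function.surjInv_eq hq
  have hψ : ∀ σ, c.1 (s (q σ)) = c.1 σ := fun σ =>
    oneCocycle_apply_eq_of_q_eq HA q X c hc (hs (q σ))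
  let ψ : contOneCocycles X :=
    ⟨⟨fun τ => c.1 (s τ), continuous_of_discreteTopology⟩, fun τ τ' => by
      change c.1 (s (τ * τ')) = c.1 (s τ) + X.ρ τ (c.1 (s τ'))
      have h1 : c.1 (s (τ * τ')) = c.1 (s τ * s τ') :=
        oneCocycle_apply_eq_of_q_eq HA q X c hc (by rw [map_mul, hs, hs, hs])
      rw [h1, c.2 (s τ) (s τ')]
      change c.1 (s τ) + X.ρ (q (s τ)) (c.1 (s τ')) = _
      rw [hs]⟩
  refine ⟨oneCocycleClass X ψ, ?_⟩
  have hmap : (infl HA q X 1).hom (oneCocycleClass X ψ) =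
      oneCocycleClass _ (contOneCocycles.pullback q (𝟙 (TopRep.res (q : H →* HA) X)) ψ) :=
    map_oneCocycleClass X q (𝟙 _) ψ
  rw [hmap]
  congr 1
  apply Subtype.ext
  ext σ
  rw [contOneCocycles.pullback_apply, TopRep.id_apply]
  exact hψ σ

/-- **Definition 2.2 (ii)(c), degree one, surjectivity**: `H¹(H_A, X) → H¹(H, X)` is surjective iff
every continuous crossed homomorphism `H → X` vanishes on `Ker(H ↠ H_A)`.
[cite: MochizukiFrdII2008, Def 2.2 (ii) p.17] -/
theorem infl_one_surjective_iff (hq : Function.Surjective q) (X : TopRep.{0} ℤ HA) :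
    Function.Surjective (infl HA q X 1).hom ↔
      ∀ c : contOneCocycles (TopRep.res (q : H →* HA) X), ∀ σ, q σ = 1 → c.1 σ = 0 := by
  constructor
  · intro h c
    exact (mem_range_infl_one_iff HA q hq X c).mp (h _)
  · intro h y
    obtain ⟨c, rfl⟩ := oneCocycleClass_surjective _ y
    exact (mem_range_infl_one_iff HA q hq X c).mpr (h c)

/-- **Definition 2.2 (ii)(c), degree one**: the "isomorphism" clause `H¹(H_A, X) ⥲ H¹(H, X)` holds
iff every continuous crossed homomorphism `H → X` vanishes on `Ker(H ↠ H_A)` (injectivity being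
automatic, `infl_one_injective`). [cite: MochizukiFrdII2008, Def 2.2 (ii) p.17] -/
theorem infl_one_bijective_iff (hq : Function.Surjective q) (X : TopRep.{0} ℤ HA) :
    Function.Bijective (infl HA q X 1).hom ↔
      ∀ c : contOneCocycles (TopRep.res (q : H →* HA) X), ∀ σ, q σ = 1 → c.1 σ = 0 := by
  rw [Function.Bijective, infl_one_surjective_iff HA q hq X,
    and_iff_right (infl_one_injective HA q hq X)]

end Range

end Kummer

namespace PadicKummer

namespace Def22Context

variable (X : Def22Context) (N : ℕ)

/-- **Definition 2.2 (ii)** for any context `X`, with the `H¹`-clauses of (c) in "extension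
field-theoretic" form: `A` is `(N, H)`-saturated iff (a) `μ_N(A) ≅ ℤ/Nℤ`, (b) `A_D` is Galois,
(c₁) every continuous crossed homomorphism `H → μ_N(A)` vanishes on `Ker(H ↠ H_A)`, (c₂) every
continuous homomorphism `H → ℤ/Nℤ` vanishes on `Ker(H ↠ H_A)` (crossed homomorphisms for the
trivial action), (c₃) `H²(H_A, μ_N(A)) → H²(H, μ_N(A))` is surjective.
[cite: MochizukiFrdII2008, Def 2.2 (ii) p.17] -/
theorem isNHSaturated_iff_oneCocycles :
    IsNHSaturated X N ↔ Kummer.IsMuSaturated N X.O ∧ X.isGalois ∧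
      (∀ c : contOneCocycles (TopRep.res (X.qHA : X.H →* X.HA) (Kummer.muTopRep N X.O X.HA)),
          ∀ σ, X.qHA σ = 1 → c.1 σ = 0) ∧
        (∀ c : contOneCocycles (TopRep.res (X.qHA : X.H →* X.HA) (Kummer.trivTopRep N X.HA)),
            ∀ σ, X.qHA σ = 1 → c.1 σ = 0) ∧
          Function.Surjective (Kummer.infl X.HA X.qHA (Kummer.muTopRep N X.O X.HA) 2).hom := by
  rw [isNHSaturated_iff_surjective, Kummer.infl_one_surjective_iff X.HA X.qHA X.toHA_surjective,
    Kummer.infl_one_surjective_iff X.HA X.qHA X.toHA_surjective]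

end Def22Context

end PadicKummer

end Literature.AlgebraicGeometry.Frobenioids
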